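import Mathlib
import Summits.CriticalPhenomena.CardyFormulaZ2.Theorems.CardySelfRefinementRussoDriftPolynomial
import Literature.Probability.Percolation.ProdBernoulliRusso
import Summits.CriticalPhenomena.CardyFormulaZ2.Theorems.CardySelfRefinementGradientComparabilityStubRussoWithinSigned
import HarnessLib

/-!
# Crux `GradientComparability` (stmt-CriticalPhenomena-10269), line `Sketch` — stub
# `stub_Drho_eq_signed_sum`: the Russo dictionary in the `ρ`-direction (signed)

Route `CardySelfRefinement`, sub-problem `CriticalPhenomena/CardyFormulaZ2`; vocabulary from
`CardySelfRefinementDefs` (`prm`, `cfg`, `Aloc`, `coinWindow`, `window`, `P`, `Dρ`).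

For the self-refinement model `M_k(ρ,c) = (prodBernoulli (prm k ρ c)).map (cfg k)` the only coins
whose bias depends on `ρ` are the SELECTOR coins (`j = 2`, bias `projIcc 0 1 ρ`, equal to `ρ` on
`[0,1]`); the pulled-back localised crossing event `E = cfg k ⁻¹' Aloc m F η` is determined by the
finite coin window but is NOT monotone in the selectors.  Russo's formula in signed form, within
`[0,1]` (`stub_russoWithin_signed`, landed), therefore gives, for `η ≠ 0`, `ρ ∈ [0,1]`, any `c`:

`∂ρP(ρ,c) = Σ_{selector coins i of the coin window} (P(E | i forced on) − P(E | i forced off))`,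

the one-sided `derivWithin` on `[0,1]` being that derivative by uniqueness (`uniqueDiffOn_Icc`).
(Grimmett 1999 Thm 2.25 / Russo 1981 §4 Lemma 3, multi-parameter signed form.)
-/

noncomputable section

namespace Summit.CriticalPhenomena.CardyFormulaZ2.Theorems.CardySelfRefinement

open scoped Topology
open Filter Set MeasureTheory
open Literature.Probability.LatticeModels Literature.Probability.Percolation
open Literature.Probability.Percolation.QuadCrossing
open Summit.CriticalPhenomena.CardyFormulaZ2.Theses.CardySelfRefinement

/-- `P` on the coin side: for `η ≠ 0`, `P k m F η ρ c` is the coin probability of the pulled-back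
localised crossing event `cfg k ⁻¹' Aloc m F η`. -/
theorem P_eq_real_preimage_Aloc (k m : ℕ) (F : Fin m → Quad (Set.univ : Set ℂ)) {η : ℝ}
    (hη : η ≠ 0) (ρ c : ℝ) :
    P k m F η ρ c = (prodBernoulli (prm k ρ c)).real ((cfg k) ⁻¹' Aloc m F η) := by
  rw [P_eq_real_Aloc, Measure.real, Measure.map_apply (measurable_cfg k) (measurableSet_Aloc m F hη),
    ← Measure.real]

/-- The bias of a selector coin is `ρ` itself on `[0,1]`, so it has derivative `1` within `[0,1]`. -/
theorem hasDerivWithinAt_prm_selector (k : ℕ) (c : ℝ) {i : Site 2 × Fin 2 × Fin 3} (hi : i.2.2 = 2)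
    {ρ : ℝ} (hρ : ρ ∈ Set.Icc (0 : ℝ) 1) :
    HasDerivWithinAt (fun b : ℝ => (prm k b c i : ℝ)) 1 (Set.Icc 0 1) ρ := by
  have hid : HasDerivWithinAt (fun b : ℝ => b) 1 (Set.Icc 0 1) ρ := hasDerivWithinAt_id ρ _
  refine hid.congr_of_mem (fun b hb => ?_) hρ
  have h2 : ¬ (i.2.2 = 0) := by rw [hi]; decide
  have h1 : ¬ (i.2.2 = 1) := by rw [hi]; decide
  simp only [prm, h2, if_false, h1, Set.projIcc_of_mem _ hb]

/-- The biases of own and shared coins do not depend on `ρ`. -/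
theorem hasDerivWithinAt_prm_of_ne (k : ℕ) (c : ℝ) {i : Site 2 × Fin 2 × Fin 3} (hi : i.2.2 ≠ 2)
    (ρ : ℝ) :
    HasDerivWithinAt (fun b : ℝ => (prm k b c i : ℝ)) 0 (Set.Icc 0 1) ρ := by
  obtain ⟨v, d, j⟩ := i
  have hconst : (fun b : ℝ => (prm k b c (v, d, j) : ℝ)) = fun _ => (prm k 0 c (v, d, j) : ℝ) := by
    funext b
    fin_cases j
    · simp [prm]
    · simp [prm]
    · exact absurd rfl hi
  rw [hconst]
  exact hasDerivWithinAt_const ρ _ _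

/-- **Russo dictionary, `ρ`-direction, signed** (registered stub `stub_Drho_eq_signed_sum` of line
`Sketch`): for `η ≠ 0`, `ρ ∈ [0,1]`, any `c`, and the coin Finset `K` of the window,
`∂ρP(ρ,c) = Σ_{i ∈ K, i selector} (P(E | i on) − P(E | i off))`, `E = cfg k ⁻¹' Aloc m F η`. -/
theorem stub_Drho_eq_signed_sum (k m : ℕ) (F : Fin m → Quad (Set.univ : Set ℂ)) {η : ℝ} (hη : η ≠ 0)
    {ρ : ℝ} (hρ : ρ ∈ Set.Icc (0 : ℝ) 1) (c : ℝ) (K : Finset (Site 2 × Fin 2 × Fin 3))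
    (hK : (↑K : Set (Site 2 × Fin 2 × Fin 3)) = coinWindow k (window m F η)) :
    Dρ k m F η (ρ, c) = ∑ i ∈ K with i.2.2 = 2,
      ((prodBernoulli (prm k ρ c)).real {S | insert i S ∈ (cfg k) ⁻¹' Aloc m F η} -
        (prodBernoulli (prm k ρ c)).real {S | S \ {i} ∈ (cfg k) ⁻¹' Aloc m F η}) := by
  classical
  -- the coin-side event and its finite support
  set E : Set (Set (Site 2 × Fin 2 × Fin 3)) := (cfg k) ⁻¹' Aloc m F η with hE
  have hdet : DeterminedBy E (↑K : Set _) := by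
    rw [hE, hK]; exact determinedBy_preimage_Aloc k m F η
  -- the parametrised function and its derivative within `[0,1]`
  have hfun : (fun ρ' => P k m F η ρ' c) = fun ρ' => (prodBernoulli (prm k ρ' c)).real E := by
    funext ρ'
    rw [P_eq_real_preimage_Aloc k m F hη ρ' c]
  set p' : Site 2 × Fin 2 × Fin 3 → ℝ := fun i => if i.2.2 = 2 then 1 else 0 with hp'
  have hp : ∀ i ∈ K, HasDerivWithinAt (fun b : ℝ => (prm k b c i : ℝ)) (p' i) (Set.Icc 0 1) ρ := by
    intro i _
    by_cases hi : i.2.2 = 2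
    · simp only [hp', hi, if_true]
      exact hasDerivWithinAt_prm_selector k c hi hρ
    · simp only [hp', hi, if_false]
      exact hasDerivWithinAt_prm_of_ne k c hi ρ
  have hderiv := stub_russoWithin_signed (fun b => prm k b c) E hdet (Set.Icc 0 1) ρ p' hp
  -- `Dρ` is that derivative (unique derivatives within `[0,1]`)
  have hD : Dρ k m F η (ρ, c) = ∑ i ∈ K, p' i *
      ((prodBernoulli (prm k ρ c)).real {S | insert i S ∈ E} -
        (prodBernoulli (prm k ρ c)).real {S | S \ {i} ∈ E}) := by
    simp only [Dρ]
    rw [hfun]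
    exact hderiv.derivWithin (uniqueDiffOn_Icc zero_lt_one ρ hρ)
  rw [hD, Finset.sum_filter]
  refine Finset.sum_congr rfl fun i _ => ?_
  by_cases hi : i.2.2 = 2
  · simp only [hp', hi, if_true, one_mul]
  · simp only [hp', hi, if_false, zero_mul]

end Summit.CriticalPhenomena.CardyFormulaZ2.Theorems.CardySelfRefinement

end
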